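import Summits.QuantumFields.BalabanUV.Beta.GAN24.AveragedPropagatorOneStepCubic
import Summits.QuantumFields.BalabanUV.Beta.GAN24.ScalarUnitLatticeTower

/-!
# G-an2-4 ∕ (CONV-C), road P2, VECTOR LAYER — THE TOWER `k ↦ c_{L^k}(1) = Q_{L^k}𝒢_{L^k}Q_{L^k}*` OF BAŁABAN's AVERAGED PROPAGATOR ON A
# CUBIC UNIT TORUS, `U = 1`, `a = 1`: k-UNIFORM SUP BOUND, GEOMETRIC ONE-STEP RATE `θ = L^{−1∕2}`, AND THE LIMIT `c_∞` WITH
# `‖((c_{L^k} − c_∞)g)(i)‖ ≤ C₅·θ^k·|g|_∞` — the tower reading `N = L^k`, `R = L` of `AveragedPropagatorOneStepCubic`, typed; UNCONDITIONAL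

G-an2-4 formalisation swarm `b2b-balaban-gan24-formalise-*`, leaf prover 04 (gen 50), crux team (2) under the coordinator ruling «YM REDIRECT»
(e34b3e0c; FREEZE (0) honoured — a `GAN24/` corollary importing EXISTING modules only; filed on the road-P2 chair `b2b-balaban-gan24-p2`
(gen 30)'s open invitation, HOME/INBOX.md 2026-08-21T11:4xZ «the swarm is welcome to the tower corollary of (C3) à la `ScalarUnitLatticeTower`»).
INPUT, BY NAME and nothing else estimated: the chair's Part 6 = (C3)
`AveragedPropagatorOneStepCubic.norm_covOp_succ_sub_mulVec_le_cubic (d) : ∃ K > 0, ∀ N R N₀ ≥ 1, |g| ≤ b →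
  ‖((covOp (R·N) T 1 − covOp N T 1) g)(i)‖ ≤ K·((R−1)∕(RN))·(2 + log(RN) + log N)·b`  (`T = fun _ : Fin (d+1) ⇒ N₀`,
`covOp n M a := QvOp n M * (DeltaA n M a)⁻¹ * QvAdj n M` = Bałaban's `Q_k𝒢_kQ_k*`, [Balaban1984PropagatorsI] (1.99) — a TEXT LOCATION, nothing
printed is asserted), its zeroth letter `exists_sup_inv_one`, the elementary means `StaircaseAveragingDefect.norm_QvOp_mulVec_le` ∕
`norm_QvAdj_mulVec_le`, and the two real-variable lemmas `ScalarUnitLatticeTower.tower_rate_le` (leaf-06 gen 36) ∕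
`T4FlagMemoryPolyWeight.succ_mul_pow_le` (lit).  THIS FILE:
 * §1 `covOp_level_congr` (re-indexing along `L^{k+1} = L·L^k`) and **`norm_covOp_mulVec_le`** — the k-UNIFORM sup bound
   `‖(c_n(1)g)(i)‖ ≤ C₀·b` for EVERY `n ≥ 1` and EVERY torus in dimension `d + 1` (`|Q|, |Q*| ≤ 1` as means, `‖Δ_1⁻¹‖_{∞→∞} ≤ C₀`);
 * §2 **`norm_covOp_tower_step_le_cubic`** — `∃ K′ > 0` (function of `d`): for every `L, N₀ ≥ 1`, every `k`, every bounded unit bond field `g`,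
   `‖((c_{L^{k+1}} − c_{L^k})g)(i)‖ ≤ K′·(1 + log L)·(k+1)·L^{−k}·b` — (C3) at `N = L^k`, `R = L` (`(L−1)∕L^{k+1}·(2 + (2k+1) log L) ≤ 2(1 + log L)(k+1)L^{−k}`);
 * §3 **`convC_shape_covOp_tower_cubic`** — THE TWO-CLAUSE SHAPE in sup → sup currency: `∃ C₀ ≥ 0` (d) and `∀ L ≥ 2, ∃ C₄ > 0` (d, L) with, for
   every `N₀ ≥ 1`, `k`, `g`, `i`: `‖(c_{L^k}g)(i)‖ ≤ C₀·b` ∧ `‖((c_{L^{k+1}} − c_{L^k})g)(i)‖ ≤ C₄·(1∕√L)^k·b` (`(k+1)L^{−k} = ((k+1)y^k)y^k ≤ y^k∕(1−y)`,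
   `y = 1∕√L`);
 * §4 **`tendsto_covOp_tower_cubic`** — THE LIMIT: `∀ L ≥ 2, ∃ C₅ > 0` (d, L), `∀ N₀ ≥ 1, ∃ c_∞ : Matrix`, `∀ g` with `|g| ≤ b`, `∀ i`:
   `(c_{L^k}g)(i) → (c_∞g)(i)` (`k → ∞`), `‖((c_{L^k} − c_∞)g)(i)‖ ≤ C₅·(1∕√L)^k·b` and `‖(c_∞g)(i)‖ ≤ C₅·b` — §3 clause 2 summed geometrically
   (`cauchySeq_of_le_geometric` entrywise on the FIXED finite index set, completeness of `ℂ`, `mulVec` of the entrywise limit = limit of `mulVec` by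
   the finite sum, `dist_le_of_le_geometric_of_tendsto`); `C₅ = C₀ + C₄∕(1 − 1∕√L)`.
READING.  With `N = L^k` the one-step law of (C3) is summable in `k`; §4 is the `|s_k − s_∞| ≤ c₀θ^k` SHAPE (the «conv» half of the row's
currency, cf. `Beta.RateCertificate` ∕ `Beta.Assembly.LimitForm.conv`) for the VECTOR unit-lattice constituent `Q_k𝒢_kQ_k*` in sup → sup currency,
UNIFORMLY IN THE UNIT TORUS (constants free of `N₀`).  Per referee wording R213-2: the limit `c_∞` is NAMED as a limit on the fixed finite carrier
`Tor T × Fin (d+1)`, NOT identified with any continuum or Bałaban kernel; no consumer predicate (`LimitForm.conv`, `DirichletExhaustion.ConvC`) is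
instantiated here.
HONEST SCOPE.  [folklore] corollary of tree theorems BY NAME (one `obtain` per input + real analysis); `U = 1`, `a = 1`, CUBIC unit tori in dimension
`d + 1`, the unit torus FIXED along the tower, sup → sup currency, the UNIT-LATTICE-READ vector constituent only (no decay clause, no inverse
`(Q𝒢Q*)⁻¹`, no fine constituents `H_k` ∕ `G_k(1)`, no general `a`, non-abelian nothing); `θ = L^{−1∕2}` is a typing convenience absorbing `(k+1)`
(any `θ > L⁻¹` would do; the one-step factor itself is `(1 + log L)(k+1)L^{−k}`); constants EXISTENTIAL (the suppliers').  NOT (CONV-C) as typed,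
NEVER «G-an2-4 closed», NOT NE2 ∕ NE3, NOT D1, NOT BetaPertH, NOT continuum, NOT Clay; 0 def, 0 `def … : Prop`, 0 cite tag, no sorry — not in
print, our bookkeeping.  HONEST DEPENDENCY: continuum YM on T⁴ ⇐ BetaPertH ∧ nine spine estimates (0/9 proved); BetaPertH ⇐ (D1) ∧ (D4) ∧
CAP+tail; G-an2-4 gates asym, D1 and NE2/3/4.
-/

noncomputable section

open scoped BigOperators ComplexConjugate Matrix

namespace Summit.QuantumFields.BalabanUV.Beta.GAN24.AveragedPropagatorTowerCubic

open Filter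
open Literature.MathematicalPhysics.QuantumFieldTheory.Balaban1983to89
open B5Prop11Plancherel (Tor fine)
open B5Block118 (QvOp)
open B5DeltaA169 (DeltaA QvAdj)
open Summit.QuantumFields.BalabanUV.Beta.GAN24.StaircaseAveragingDefect (norm_QvOp_mulVec_le norm_QvAdj_mulVec_le)
open Summit.QuantumFields.BalabanUV.Beta.GAN24.AveragedPropagatorTwoLevel (covOp)
open Summit.QuantumFields.BalabanUV.Beta.GAN24.AveragedPropagatorOneStepCubic
  (norm_covOp_succ_sub_mulVec_le_cubic exists_sup_inv_one)
open Summit.QuantumFields.BalabanUV.Beta.GAN24.ScalarUnitLatticeTower (tower_rate_le)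
open T4FlagMemoryPolyWeight (succ_mul_pow_le)

variable (d : ℕ)

/-! ## §1 Re-indexing and the k-uniform sup bound of `c_n(1) = Q_n𝒢_nQ_n*` -/

/-- re-indexing the level of `covOp` along an equality of naturals (the `NeZero` instance is a proposition). [folklore] -/
theorem covOp_level_congr {d' : ℕ} {M : Fin d' → ℕ} [∀ μ, NeZero (M μ)] {n m : ℕ} [NeZero n] [NeZero m] (h : n = m) (a : ℝ) :
    covOp n M a = covOp m M a := by
  subst h; rfl

/-- **k-UNIFORM SUP BOUND**: `∃ C₀ ≥ 0` (a function of `d`) with `‖(c_n(1)g)(i)‖ ≤ C₀·sup|g|` for EVERY `n ≥ 1` and EVERY torus in dimension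
`d + 1` — `Q`, `Q*` are means (`StaircaseAveragingDefect.norm_QvOp_mulVec_le` ∕ `norm_QvAdj_mulVec_le`) and `‖Δ_1⁻¹‖_{ℓ^∞→ℓ^∞} ≤ C₀`
(`AveragedPropagatorOneStepCubic.exists_sup_inv_one` = lit-balaban's (1.115)-type global bound). [folklore] -/
theorem norm_covOp_mulVec_le :
    ∃ C₀ : ℝ, 0 ≤ C₀ ∧ ∀ (n : ℕ) [NeZero n] (M : Fin (d + 1) → ℕ) [∀ μ, NeZero (M μ)]
      (g : Tor M × Fin (d + 1) → ℂ) (b : ℝ), (∀ j, ‖g j‖ ≤ b) → ∀ i, ‖(covOp n M 1 *ᵥ g) i‖ ≤ C₀ * b := by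
  obtain ⟨C₀, hC₀, h0⟩ := exists_sup_inv_one d
  refine ⟨C₀, hC₀, fun n _ M _ g b hg i => ?_⟩
  rw [covOp, ← Matrix.mulVec_mulVec, ← Matrix.mulVec_mulVec]
  exact norm_QvOp_mulVec_le M n _ _ (h0 n M _ _ (norm_QvAdj_mulVec_le M n g b hg)) i

/-! ## §2 The one-step law along the tower `N = L^k`, `R = L` -/

/-- **THE TOWER STEP, UNCONDITIONAL**: `∃ K′ > 0` (a function of `d`) such that for every `L ≥ 1`, every `N₀ ≥ 1`, every level `k`, every unit
bond field `g` with `|g| ≤ b` and every unit bond `i` of the cubic torus `Π_{μ<d+1} ℤ∕N₀`,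
`‖((c_{L^{k+1}}(1) − c_{L^k}(1))g)(i)‖ ≤ K′·(1 + log L)·(k+1)·L^{−k}·b`. [folklore] -/
theorem norm_covOp_tower_step_le_cubic :
    ∃ K : ℝ, 0 < K ∧ ∀ (L N₀ : ℕ) [NeZero L] [NeZero N₀] (k : ℕ)
      (g : Tor (fun _ : Fin (d + 1) => N₀) × Fin (d + 1) → ℂ) (b : ℝ), (∀ j, ‖g j‖ ≤ b) →
        ∀ i : Tor (fun _ : Fin (d + 1) => N₀) × Fin (d + 1),
          ‖((covOp (L ^ (k + 1)) (fun _ : Fin (d + 1) => N₀) 1 - covOp (L ^ k) (fun _ : Fin (d + 1) => N₀) 1) *ᵥ g) i‖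
            ≤ K * (1 + Real.log (L : ℝ)) * ((k : ℝ) + 1) / (L : ℝ) ^ k * b := by
  obtain ⟨K, hK, h⟩ := norm_covOp_succ_sub_mulVec_le_cubic d
  refine ⟨2 * K, by positivity, fun L N₀ _ _ k g b hg i => ?_⟩
  have hL : (1 : ℝ) ≤ L := by exact_mod_cast Nat.one_le_iff_ne_zero.mpr (NeZero.ne L)
  have hb : 0 ≤ b := (norm_nonneg _).trans (hg i)
  have key := h (L ^ k) L N₀ g b hg i
  rw [covOp_level_congr (pow_succ' L k) 1]
  push_cast at key
  rw [show (L : ℝ) * (L : ℝ) ^ k = (L : ℝ) ^ (k + 1) from (pow_succ' _ _).symm, Real.log_pow, Real.log_pow] at key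
  have hr := tower_rate_le hL k
  calc ‖((covOp (L * L ^ k) (fun _ : Fin (d + 1) => N₀) 1 - covOp (L ^ k) (fun _ : Fin (d + 1) => N₀) 1) *ᵥ g) i‖
      ≤ K * (((L : ℝ) - 1) / (L : ℝ) ^ (k + 1)) * (2 + ((k + 1 : ℕ) : ℝ) * Real.log L + (k : ℝ) * Real.log L) * b := key
    _ = K * (((L : ℝ) - 1) / (L : ℝ) ^ (k + 1) * (2 + ((k : ℝ) + 1) * Real.log L + (k : ℝ) * Real.log L)) * b := by
        push_cast; ring
    _ ≤ K * (2 * (1 + Real.log L) * ((k : ℝ) + 1) / L ^ k) * b :=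
        mul_le_mul_of_nonneg_right (mul_le_mul_of_nonneg_left hr hK.le) hb
    _ = 2 * K * (1 + Real.log (L : ℝ)) * ((k : ℝ) + 1) / (L : ℝ) ^ k * b := by ring

/-! ## §3 The two clauses of the (CONV-C) shape, sup → sup currency, for the vector constituent `k ↦ c_{L^k}(1)` -/

/-- **THE TWO-CLAUSE SHAPE FOR `Q_k𝒢_kQ_k*` ON CUBIC UNIT TORI, sup → sup, UNCONDITIONAL.**  There is `C₀ ≥ 0` (a function of `d`) and, for every
`L ≥ 2`, a `C₄ > 0` (a function of `d, L`) such that for every `N₀ ≥ 1`, every level `k`, every unit bond field `g` with `|g| ≤ b` and every unit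
bond `i`: `‖(c_{L^k}(1)g)(i)‖ ≤ C₀·b` (k-UNIFORM BOUND) and `‖((c_{L^{k+1}}(1) − c_{L^k}(1))g)(i)‖ ≤ C₄·(1∕√L)^k·b` (GEOMETRIC ONE-STEP RATE,
`θ = L^{−1∕2}`). [folklore] -/
theorem convC_shape_covOp_tower_cubic :
    ∃ C₀ : ℝ, 0 ≤ C₀ ∧ ∀ (L : ℕ) [NeZero L], 2 ≤ L → ∃ C₄ : ℝ, 0 < C₄ ∧
      ∀ (N₀ : ℕ) [NeZero N₀] (k : ℕ) (g : Tor (fun _ : Fin (d + 1) => N₀) × Fin (d + 1) → ℂ) (b : ℝ), (∀ j, ‖g j‖ ≤ b) →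
        ∀ i : Tor (fun _ : Fin (d + 1) => N₀) × Fin (d + 1),
          ‖(covOp (L ^ k) (fun _ : Fin (d + 1) => N₀) 1 *ᵥ g) i‖ ≤ C₀ * b ∧
          ‖((covOp (L ^ (k + 1)) (fun _ : Fin (d + 1) => N₀) 1 - covOp (L ^ k) (fun _ : Fin (d + 1) => N₀) 1) *ᵥ g) i‖
            ≤ C₄ * ((Real.sqrt L)⁻¹) ^ k * b := by
  obtain ⟨C₀, hC₀, h0⟩ := norm_covOp_mulVec_le d
  obtain ⟨K, hK, h⟩ := norm_covOp_tower_step_le_cubic d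
  refine ⟨C₀, hC₀, fun L _ hL2 => ?_⟩
  have hL1 : (1 : ℝ) < L := by exact_mod_cast hL2
  have hL0 : (0 : ℝ) < L := by linarith
  have hlog : 0 ≤ Real.log (L : ℝ) := Real.log_nonneg hL1.le
  set y : ℝ := (Real.sqrt L)⁻¹ with hy
  have hsq : 1 < Real.sqrt L := by
    rw [show (1 : ℝ) = Real.sqrt 1 from Real.sqrt_one.symm]
    exact Real.sqrt_lt_sqrt zero_le_one hL1
  have hy0 : 0 < y := inv_pos.mpr (by linarith)
  have hy1 : y < 1 := inv_lt_one_of_one_lt₀ hsq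
  have h1y : 0 < 1 - y := by linarith
  have hyy : ∀ k : ℕ, ((L : ℝ) ^ k)⁻¹ = y ^ k * y ^ k := fun k => by
    rw [hy, ← mul_pow, ← mul_inv, Real.mul_self_sqrt hL0.le, inv_pow]
  refine ⟨K * (1 + Real.log L) / (1 - y), by positivity, ?_⟩
  intro N₀ _ k g b hg i
  have hb : 0 ≤ b := (norm_nonneg _).trans (hg i)
  refine ⟨h0 (L ^ k) _ g b hg i, ?_⟩
  have h2 := h L N₀ k g b hg i
  have hgeo := succ_mul_pow_le hy0.le hy1 k
  have hyk : 0 ≤ y ^ k := pow_nonneg hy0.le k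
  have hcoef : K * (1 + Real.log (L : ℝ)) * ((k : ℝ) + 1) / (L : ℝ) ^ k ≤ K * (1 + Real.log L) / (1 - y) * y ^ k :=
    calc K * (1 + Real.log (L : ℝ)) * ((k : ℝ) + 1) / (L : ℝ) ^ k
        = K * (1 + Real.log (L : ℝ)) * (((k : ℝ) + 1) * y ^ k) * y ^ k := by
          rw [div_eq_mul_inv, hyy k]; ring
      _ ≤ K * (1 + Real.log (L : ℝ)) * (1 / (1 - y)) * y ^ k :=
          mul_le_mul_of_nonneg_right (mul_le_mul_of_nonneg_left hgeo (by positivity)) hyk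
      _ = K * (1 + Real.log L) / (1 - y) * y ^ k := by ring
  exact h2.trans (mul_le_mul_of_nonneg_right hcoef hb)

/-! ## §4 The limit along the tower: `c_{L^k}(1) → c_∞` in sup → sup currency with geometric rate, uniformly in the unit torus -/

/-- entry `(i, j)` of a square complex matrix as `mulVec` of the `j`-th unit vector. [folklore] -/
theorem mulVec_single_one_apply {ι : Type*} [Fintype ι] [DecidableEq ι] (A : Matrix ι ι ℂ) (i j : ι) :
    (A *ᵥ Pi.single j (1 : ℂ)) i = A i j := by
  simp [Matrix.mulVec, dotProduct_single]

/-- the unit vector is bounded by `1`. [folklore] -/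
theorem norm_single_one_le {ι : Type*} [DecidableEq ι] (j j' : ι) : ‖(Pi.single j (1 : ℂ) : ι → ℂ) j'‖ ≤ 1 := by
  by_cases h : j' = j
  · subst h; simp
  · simp [h]

/-- **THE TOWER LIMIT OF BAŁABAN's AVERAGED PROPAGATOR ON A CUBIC UNIT TORUS, `U = 1`, `a = 1`, UNCONDITIONAL.**  For every `L ≥ 2` there is
`C₅ > 0` (a function of `d, L`) such that on every cubic unit torus `T = Π_{μ<d+1} ℤ∕N₀` there is a matrix `c_∞` on the unit bonds with, for every
unit bond field `g` with `|g| ≤ b` and every unit bond `i`: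
`(c_{L^k}(1)g)(i) → (c_∞g)(i)` (`k → ∞`), `‖((c_{L^k}(1) − c_∞)g)(i)‖ ≤ C₅·(1∕√L)^k·b` for every `k`, and `‖(c_∞g)(i)‖ ≤ C₅·b`
— §3 clause 2 summed geometrically on the FIXED finite carrier; `C₅ = C₀ + C₄∕(1 − 1∕√L)`.  The limit is NAMED, not identified. [folklore] -/
theorem tendsto_covOp_tower_cubic :
    ∀ (L : ℕ) [NeZero L], 2 ≤ L → ∃ C₅ : ℝ, 0 < C₅ ∧
      ∀ (N₀ : ℕ) [NeZero N₀],
        ∃ cinf : Matrix (Tor (fun _ : Fin (d + 1) => N₀) × Fin (d + 1)) (Tor (fun _ : Fin (d + 1) => N₀) × Fin (d + 1)) ℂ,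
          ∀ (g : Tor (fun _ : Fin (d + 1) => N₀) × Fin (d + 1) → ℂ) (b : ℝ), (∀ j, ‖g j‖ ≤ b) →
            ∀ i : Tor (fun _ : Fin (d + 1) => N₀) × Fin (d + 1),
              Tendsto (fun k : ℕ => (covOp (L ^ k) (fun _ : Fin (d + 1) => N₀) 1 *ᵥ g) i) atTop (nhds ((cinf *ᵥ g) i)) ∧
              (∀ k : ℕ, ‖((covOp (L ^ k) (fun _ : Fin (d + 1) => N₀) 1 - cinf) *ᵥ g) i‖ ≤ C₅ * ((Real.sqrt L)⁻¹) ^ k * b) ∧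
              ‖(cinf *ᵥ g) i‖ ≤ C₅ * b := by
  intro L _ hL2
  obtain ⟨C₀, hC₀, hall⟩ := convC_shape_covOp_tower_cubic d
  obtain ⟨C₄, hC₄, h⟩ := hall L hL2
  have hL1 : (1 : ℝ) < L := by exact_mod_cast hL2
  set θ : ℝ := (Real.sqrt L)⁻¹ with hθ
  have hsq : 1 < Real.sqrt L := by
    rw [show (1 : ℝ) = Real.sqrt 1 from Real.sqrt_one.symm]
    exact Real.sqrt_lt_sqrt zero_le_one hL1
  have hθ0 : 0 ≤ θ := inv_nonneg.mpr (Real.sqrt_nonneg _)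
  have hθ1 : θ < 1 := inv_lt_one_of_one_lt₀ hsq
  have h1θ : 0 < 1 - θ := by linarith
  refine ⟨C₀ + C₄ / (1 - θ), by positivity, fun N₀ _ => ?_⟩
  -- Step 1: every entry `k ↦ c_{L^k}(i, j)` is Cauchy, hence convergent (the carrier is a fixed finite set, `ℂ` is complete)
  have hent : ∀ i j : Tor (fun _ : Fin (d + 1) => N₀) × Fin (d + 1), ∃ s : ℂ,
      Tendsto (fun k : ℕ => covOp (L ^ k) (fun _ : Fin (d + 1) => N₀) 1 i j) atTop (nhds s) := by
    intro i j
    have hstep : ∀ k : ℕ, dist (covOp (L ^ k) (fun _ : Fin (d + 1) => N₀) 1 i j)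
        (covOp (L ^ (k + 1)) (fun _ : Fin (d + 1) => N₀) 1 i j) ≤ C₄ * 1 * θ ^ k := by
      intro k
      have h2 := (h N₀ k (Pi.single j (1 : ℂ)) 1 (norm_single_one_le j) i).2
      rw [Matrix.sub_mulVec, Pi.sub_apply, mulVec_single_one_apply, mulVec_single_one_apply] at h2
      rw [dist_comm, dist_eq_norm]
      linarith
    exact cauchySeq_tendsto_of_complete (cauchySeq_of_le_geometric θ (C₄ * 1) hθ1 hstep)
  choose cinf hcinf using hent
  refine ⟨Matrix.of cinf, fun g b hg i => ?_⟩
  have hb : 0 ≤ b := (norm_nonneg _).trans (hg i)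
  -- Step 2: `mulVec` of the entrywise limit is the limit of `mulVec` (finite sum)
  have hlim : Tendsto (fun k : ℕ => (covOp (L ^ k) (fun _ : Fin (d + 1) => N₀) 1 *ᵥ g) i) atTop
      (nhds ((Matrix.of cinf *ᵥ g) i)) := by
    simp only [Matrix.mulVec, dotProduct, Matrix.of_apply]
    exact tendsto_finsetSum _ fun j _ => (hcinf i j).mul tendsto_const_nhds
  -- Step 3: geometric summation of §3 clause 2 along the convergent sequence
  have hstep : ∀ k : ℕ, dist ((covOp (L ^ k) (fun _ : Fin (d + 1) => N₀) 1 *ᵥ g) i)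
      ((covOp (L ^ (k + 1)) (fun _ : Fin (d + 1) => N₀) 1 *ᵥ g) i) ≤ C₄ * b * θ ^ k := by
    intro k
    have h2 := (h N₀ k g b hg i).2
    rw [Matrix.sub_mulVec, Pi.sub_apply] at h2
    rw [dist_comm, dist_eq_norm]
    linarith
  have hdist : ∀ k : ℕ, dist ((covOp (L ^ k) (fun _ : Fin (d + 1) => N₀) 1 *ᵥ g) i) ((Matrix.of cinf *ᵥ g) i)
      ≤ C₄ * b * θ ^ k / (1 - θ) := fun k =>
    dist_le_of_le_geometric_of_tendsto θ (C₄ * b) hθ1 hstep hlim k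
  have hCb : 0 ≤ C₄ / (1 - θ) * b := by positivity
  refine ⟨hlim, fun k => ?_, ?_⟩
  · have hk := hdist k
    rw [dist_eq_norm] at hk
    have hθk : 0 ≤ θ ^ k := pow_nonneg hθ0 k
    rw [Matrix.sub_mulVec, Pi.sub_apply]
    calc _ ≤ C₄ * b * θ ^ k / (1 - θ) := hk
      _ = C₄ / (1 - θ) * θ ^ k * b := by ring
      _ ≤ (C₀ + C₄ / (1 - θ)) * θ ^ k * b := by
          have : 0 ≤ C₀ * θ ^ k * b := by positivity
          nlinarith
  · have hk := hdist 0
    rw [dist_eq_norm, pow_zero θ, mul_one] at hk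
    have hc1 : ‖(covOp (L ^ 0) (fun _ : Fin (d + 1) => N₀) 1 *ᵥ g) i‖ ≤ C₀ * b := (h N₀ 0 g b hg i).1
    have htri : ‖(Matrix.of cinf *ᵥ g) i‖ ≤ ‖(covOp (L ^ 0) (fun _ : Fin (d + 1) => N₀) 1 *ᵥ g) i‖
        + ‖(covOp (L ^ 0) (fun _ : Fin (d + 1) => N₀) 1 *ᵥ g) i - (Matrix.of cinf *ᵥ g) i‖ := by
      have := norm_sub_le ((covOp (L ^ 0) (fun _ : Fin (d + 1) => N₀) 1 *ᵥ g) i)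
        ((covOp (L ^ 0) (fun _ : Fin (d + 1) => N₀) 1 *ᵥ g) i - (Matrix.of cinf *ᵥ g) i)
      rwa [sub_sub_cancel] at this
    calc ‖(Matrix.of cinf *ᵥ g) i‖ ≤ _ := htri
      _ ≤ C₀ * b + C₄ * b / (1 - θ) := add_le_add hc1 hk
      _ = (C₀ + C₄ / (1 - θ)) * b := by ring

end Summit.QuantumFields.BalabanUV.Beta.GAN24.AveragedPropagatorTowerCubic

end
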